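import Mathlib
import HarnessLib

/-!
# Route ZeroEnergyKerrOrBomb · crux `StationaryLimitReduction` (stmt-FinalStateConjecture-10021), line
# `one-locked-explosion` — the FLAT PHASE-LOCKING lemmas of the lock (Mathlib-level analysis)

Helper file (`--supports stmt-FinalStateConjecture-10021`; registered helper `contDiff_flatPhaseLocking`) from the
lead's wave-1 stub-worker for `stub_lockedEscape` (lead prover-line-stmt-FinalStateConjecture-10021-0, 2026-08-16).
The escape curve of the line kicks the datum with flat, PHASE-LOCKED amplitudes
`s ↦ e^{-1/s²} cos(α/s²)`, `s ↦ e^{-1/s²} sin(α/s²)` (value `0` at `s = 0`; in Lean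
`expNegInvGlue (s ^ 2) * Real.cos (α / s ^ 2)`), plus the odd flat term `s e^{-1/s²}` for injectivity; joint
smoothness of the curve at `s = 0` needs these to be `C^∞` on `ℝ`. Proved here:

* `trigFlat α p q` = `x ↦ (p(x⁻¹) cos(α x⁻¹) + q(x⁻¹) sin(α x⁻¹)) · expNegInvGlue x` (`p q ∈ ℝ[X]`), its vanishing
  on `x ≤ 0`, its limit `0` at `0`, its derivative — a germ of the same shape with coefficients
  `(X²(p − p′ − αq), X²(q − q′ + αp))` (`hasDerivAt_trigFlat`) — hence `contDiff_trigFlat` by induction (the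
  pattern of Mathlib's `expNegInvGlue.contDiff_polynomial_eval_inv_mul`);
* `contDiff_flatPhaseLocking_cos/_sin` (compose with `s ↦ s²`) and the formula read-backs (the odd flat term
  is the tree's `Theorems.StationaryLimitReduction.Negative.contDiff_oddFlat`, Negative/LockGerms.lean)
  `flatPhaseLocking_cos_of_ne_zero`, `flatPhaseLocking_cos_zero`;
* the TEMPERED flat lemma `contDiff_expNegInvGlue_sq_mul_of_tempered`: `e^{-1/s²} g₀(s)` is `C^∞` for every
  derivative tower `g_k′ = g_{k+1} − 2 s⁻³ g_k` with tempered bounds `|g_k| ≤ C_k |s|^{-m_k}` near `0` — the form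
  needed for the non-rational phase laws forced by a rate-free settling hypothesis (the compensating phase then
  carries the datum's own tail offset and is only tempered-smooth in `s`).

No named fact; Mathlib only. References: Christodoulou, Ann. Math. 149 (1999) (codimension-one families);
Mathlib `Analysis.SpecialFunctions.SmoothTransition` (`expNegInvGlue`).
-/

set_option linter.dupNamespace false

noncomputable section

open Filter Topology Set
open scoped Topology ContDiff

namespace Summit.FinalStateConjecture.FinalStateConjecture.Theorems.OneLockedExplosion

section FlatPhaseLocking

open Polynomial

/-- The trigonometric-polynomial flat germ `x ↦ (p(x⁻¹) cos(α x⁻¹) + q(x⁻¹) sin(α x⁻¹)) e^{-1/x}` (`0` for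
`x ≤ 0`). [folklore] -/
def trigFlat (α : ℝ) (p q : ℝ[X]) (x : ℝ) : ℝ :=
  (p.eval x⁻¹ * Real.cos (α * x⁻¹) + q.eval x⁻¹ * Real.sin (α * x⁻¹)) * expNegInvGlue x

/-- The cosine coefficient of the derivative of `trigFlat α p q`: `X² (p − p′ − α q)`. [folklore] -/
def trigFlatNextP (α : ℝ) (p q : ℝ[X]) : ℝ[X] := X ^ 2 * (p - derivative p - C α * q)

/-- The sine coefficient of the derivative of `trigFlat α p q`: `X² (q − q′ + α p)`. [folklore] -/
def trigFlatNextQ (α : ℝ) (p q : ℝ[X]) : ℝ[X] := X ^ 2 * (q - derivative q + C α * p)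

/-- `trigFlat α p q` vanishes on `(-∞, 0]`. [folklore] -/
theorem trigFlat_of_nonpos (α : ℝ) (p q : ℝ[X]) {x : ℝ} (hx : x ≤ 0) : trigFlat α p q x = 0 := by
  simp [trigFlat, expNegInvGlue.zero_of_nonpos hx]

/-- `trigFlat α p q → 0` at `0` (bounded trigonometric factors times Mathlib's
`expNegInvGlue.tendsto_polynomial_inv_mul_zero`). [folklore] -/
theorem tendsto_trigFlat_zero (α : ℝ) (p q : ℝ[X]) : Tendsto (trigFlat α p q) (𝓝 0) (𝓝 0) := by
  have hp := expNegInvGlue.tendsto_polynomial_inv_mul_zero p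
  have hq := expNegInvGlue.tendsto_polynomial_inv_mul_zero q
  have h1 : Tendsto (fun x ↦ Real.cos (α * x⁻¹) * (p.eval x⁻¹ * expNegInvGlue x)) (𝓝 0) (𝓝 0) := by
    refine squeeze_zero_norm (fun x ↦ ?_) (tendsto_zero_iff_norm_tendsto_zero.1 hp)
    rw [norm_mul]
    refine mul_le_of_le_one_left (norm_nonneg _) ?_
    rw [Real.norm_eq_abs]
    exact Real.abs_cos_le_one _
  have h2 : Tendsto (fun x ↦ Real.sin (α * x⁻¹) * (q.eval x⁻¹ * expNegInvGlue x)) (𝓝 0) (𝓝 0) := by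
    refine squeeze_zero_norm (fun x ↦ ?_) (tendsto_zero_iff_norm_tendsto_zero.1 hq)
    rw [norm_mul]
    refine mul_le_of_le_one_left (norm_nonneg _) ?_
    rw [Real.norm_eq_abs]
    exact Real.abs_sin_le_one _
  have h := h1.add h2
  rw [add_zero] at h
  refine h.congr fun x ↦ ?_
  simp only [trigFlat]
  ring

/-- **The derivative of a trigonometric-polynomial flat germ is one of the same shape**:
`(trigFlat α p q)′ = trigFlat α (X²(p − p′ − αq)) (X²(q − q′ + αp))` everywhere on `ℝ`. [folklore] -/
theorem hasDerivAt_trigFlat (α : ℝ) (p q : ℝ[X]) (x : ℝ) :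
    HasDerivAt (trigFlat α p q) (trigFlat α (trigFlatNextP α p q) (trigFlatNextQ α p q) x) x := by
  rcases lt_trichotomy x 0 with hx | rfl | hx
  · rw [trigFlat_of_nonpos α _ _ hx.le]
    refine (hasDerivAt_const x (0 : ℝ)).congr_of_eventuallyEq ?_
    filter_upwards [gt_mem_nhds hx] with y hy
    exact trigFlat_of_nonpos α p q hy.le
  · rw [trigFlat_of_nonpos α _ _ le_rfl, hasDerivAt_iff_tendsto_slope]
    refine ((tendsto_trigFlat_zero α (p * X) (q * X)).mono_left inf_le_left).congr fun y ↦ ?_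
    simp only [slope_def_field, trigFlat, sub_zero, eval_mul, eval_X, inv_zero, mul_zero,
      expNegInvGlue.zero, Real.cos_zero, Real.sin_zero, add_zero]
    ring
  · have hu : HasDerivAt (fun y : ℝ ↦ y⁻¹) (-(x ^ 2)⁻¹) x := hasDerivAt_inv hx.ne'
    have hp : HasDerivAt (fun y : ℝ ↦ p.eval y⁻¹) ((derivative p).eval x⁻¹ * -(x ^ 2)⁻¹) x :=
      (p.hasDerivAt x⁻¹).comp x hu
    have hq : HasDerivAt (fun y : ℝ ↦ q.eval y⁻¹) ((derivative q).eval x⁻¹ * -(x ^ 2)⁻¹) x :=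
      (q.hasDerivAt x⁻¹).comp x hu
    have hcos : HasDerivAt (fun y : ℝ ↦ Real.cos (α * y⁻¹))
        (-Real.sin (α * x⁻¹) * (α * -(x ^ 2)⁻¹)) x := (hu.const_mul α).cos
    have hsin : HasDerivAt (fun y : ℝ ↦ Real.sin (α * y⁻¹))
        (Real.cos (α * x⁻¹) * (α * -(x ^ 2)⁻¹)) x := (hu.const_mul α).sin
    have hexp : HasDerivAt (fun y : ℝ ↦ Real.exp (-y⁻¹)) (Real.exp (-x⁻¹) * -(-(x ^ 2)⁻¹)) x :=
      hu.neg.exp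
    have hprod := ((hp.mul hcos).add (hq.mul hsin)).mul hexp
    have hfun : trigFlat α p q =ᶠ[𝓝 x]
        ((((fun y : ℝ ↦ p.eval y⁻¹) * fun y : ℝ ↦ Real.cos (α * y⁻¹)) +
            (fun y : ℝ ↦ q.eval y⁻¹) * fun y : ℝ ↦ Real.sin (α * y⁻¹)) *
          fun y : ℝ ↦ Real.exp (-y⁻¹)) := by
      filter_upwards [lt_mem_nhds hx] with y hy
      simp only [Pi.mul_apply, Pi.add_apply, trigFlat, expNegInvGlue, not_le.2 hy, if_false]
    refine (hprod.congr_of_eventuallyEq hfun).congr_deriv ?_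
    simp only [Pi.mul_apply, Pi.add_apply, trigFlat, trigFlatNextP, trigFlatNextQ, expNegInvGlue,
      not_le.2 hx, if_false, eval_mul, eval_sub, eval_add, eval_pow, eval_X, eval_C]
    field_simp
    ring

/-- `trigFlat α p q` is differentiable. [folklore] -/
theorem differentiable_trigFlat (α : ℝ) (p q : ℝ[X]) : Differentiable ℝ (trigFlat α p q) := fun x ↦
  (hasDerivAt_trigFlat α p q x).differentiableAt

/-- `trigFlat α p q` is continuous. [folklore] -/
theorem continuous_trigFlat (α : ℝ) (p q : ℝ[X]) : Continuous (trigFlat α p q) :=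
  (differentiable_trigFlat α p q).continuous

/-- **Every trigonometric-polynomial flat germ is `C^∞`** (induction on the order, the derivative being a
germ of the same shape). [folklore] -/
theorem contDiff_trigFlat {n : ℕ∞} (α : ℝ) (p q : ℝ[X]) : ContDiff ℝ n (trigFlat α p q) := by
  apply contDiff_all_iff_nat.2 (fun m => ?_) n
  induction m generalizing p q with
  | zero => exact contDiff_zero.2 <| continuous_trigFlat α p q
  | succ m ihm =>
    rw [show ((m + 1 : ℕ) : WithTop ℕ∞) = m + 1 from rfl]
    refine contDiff_succ_iff_deriv.2 ⟨differentiable_trigFlat α p q, by simp, ?_⟩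
    -- `convert!` (not `convert`): the domain instance `NormedAddCommGroup ℝ` arrives through
    -- `NontriviallyNormedField ℝ` on one side, directly on the other (as in Mathlib's `expNegInvGlue` proof)
    convert! ihm (trigFlatNextP α p q) (trigFlatNextQ α p q) using 2
    exact funext fun x ↦ (hasDerivAt_trigFlat α p q x).deriv

/-- **`FlatPhaseLocking` (cosine)**: the phase-locked flat amplitude `s ↦ e^{-1/s²} cos(α/s²)` of the lock
(value `0` at `s = 0`) is `C^∞` on `ℝ`, for every phase rate `α`. [folklore] -/
theorem contDiff_flatPhaseLocking_cos (α : ℝ) :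
    ContDiff ℝ ∞ (fun s : ℝ ↦ expNegInvGlue (s ^ 2) * Real.cos (α / s ^ 2)) := by
  have h : (fun s : ℝ ↦ expNegInvGlue (s ^ 2) * Real.cos (α / s ^ 2)) =
      trigFlat α 1 0 ∘ fun s : ℝ ↦ s ^ 2 := by
    funext s
    simp only [Function.comp_apply, trigFlat, eval_one, eval_zero, one_mul, zero_mul, add_zero,
      div_eq_mul_inv]
    ring
  rw [h]
  exact (contDiff_trigFlat α 1 0).comp (contDiff_id.pow 2)

/-- **`FlatPhaseLocking` (sine)**: `s ↦ e^{-1/s²} sin(α/s²)` (value `0` at `s = 0`) is `C^∞` on `ℝ`.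
[folklore] -/
theorem contDiff_flatPhaseLocking_sin (α : ℝ) :
    ContDiff ℝ ∞ (fun s : ℝ ↦ expNegInvGlue (s ^ 2) * Real.sin (α / s ^ 2)) := by
  have h : (fun s : ℝ ↦ expNegInvGlue (s ^ 2) * Real.sin (α / s ^ 2)) =
      trigFlat α 0 1 ∘ fun s : ℝ ↦ s ^ 2 := by
    funext s
    simp only [Function.comp_apply, trigFlat, eval_one, eval_zero, one_mul, zero_mul, zero_add,
      div_eq_mul_inv]
    ring
  rw [h]
  exact (contDiff_trigFlat α 0 1).comp (contDiff_id.pow 2)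

/-- Off `s = 0` the Lean rendering is the card's formula `e^{-1/s²} cos(α/s²)`. [folklore] -/
theorem flatPhaseLocking_cos_of_ne_zero (α : ℝ) {s : ℝ} (hs : s ≠ 0) :
    expNegInvGlue (s ^ 2) * Real.cos (α / s ^ 2) = Real.exp (-1 / s ^ 2) * Real.cos (α / s ^ 2) := by
  have hs2 : 0 < s ^ 2 := by positivity
  rw [expNegInvGlue, if_neg (not_le.2 hs2), neg_div, one_div]

/-- At `s = 0` the amplitude vanishes (the curve passes through the datum). [folklore] -/
theorem flatPhaseLocking_cos_zero (α : ℝ) :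
    expNegInvGlue ((0 : ℝ) ^ 2) * Real.cos (α / (0 : ℝ) ^ 2) = 0 := by
  simp

-- The odd flat companion `s ↦ s · expNegInvGlue (s²)` is `C^∞`: already in the tree as
-- `Theorems.StationaryLimitReduction.Negative.contDiff_oddFlat` (Negative/LockGerms.lean); not repeated here.

/-! ### The tempered flat lemma (non-rational phase laws)
With a rate-free `SettlesTo` the exit phase carries the offset `Φ(T(s)) = ∫₀^{T(s)} (ϖ(t) − ϖ₁) dt` of the
datum's own tail, which need not converge; the compensating phase law `α(s) = −ϖ₁ T(s) − Φ(T(s))` is then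
smooth on `s ≠ 0` with derivatives bounded by powers of `1/s` but is not `α/s²`. The lock survives because
`e^{-1/s²} · g(s)` is `C^∞` for EVERY such tempered `g` — proved here in the Leibniz-free form in which the
caller supplies the derivative tower `g_{k+1} = g_k′ + 2 s⁻³ g_k` with zeroth-order tempered bounds. -/

/-- The flat envelope `s ↦ e^{-1/s²}` has derivative `2 s⁻³ e^{-1/s²}` (both sides `0` at `s = 0`).
[folklore] -/
theorem hasDerivAt_expNegInvGlue_sq (s : ℝ) :
    HasDerivAt (fun s : ℝ ↦ expNegInvGlue (s ^ 2)) (2 * (s ^ 3)⁻¹ * expNegInvGlue (s ^ 2)) s := by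
  have h := (expNegInvGlue.hasDerivAt_polynomial_eval_inv_mul 1 (s ^ 2)).comp s (hasDerivAt_pow 2 s)
  have hfun : (fun s : ℝ ↦ expNegInvGlue (s ^ 2)) =
      (fun x : ℝ ↦ Polynomial.eval x⁻¹ (1 : Polynomial ℝ) * expNegInvGlue x) ∘ fun s : ℝ ↦ s ^ 2 := by
    funext s
    simp
  rw [hfun]
  refine h.congr_deriv ?_
  simp only [Polynomial.derivative_one, sub_zero, mul_one, Polynomial.eval_pow, Polynomial.eval_X,
    Nat.cast_ofNat]
  rcases eq_or_ne s 0 with rfl | hs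
  · simp
  · field_simp
    ring

/-- **Tempered flat lemma.** Let `g₀, g₁, …` be real functions with `g_k′ = g_{k+1} − 2 s⁻³ g_k` off
`s = 0` and `|g_k(s)| ≤ C_k |s|^{-m_k}` for `0 < |s| < 1`. Then `s ↦ e^{-1/s²} g₀(s)` (value `0` at `0`) is
`C^∞` on `ℝ`: its `k`-th derivative is `e^{-1/s²} g_k`, which tends to `0` at `0`, and a real function with a
derivative off a point, continuous there together with the candidate derivative, is differentiable at the
point (`hasDerivAt_of_hasDerivAt_of_ne`). This is the "flat × polynomially bounded derivatives" principle
behind every phase law of the lock. [folklore] -/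
theorem contDiff_expNegInvGlue_sq_mul_of_tempered (g : ℕ → ℝ → ℝ)
    (hderiv : ∀ (k : ℕ) (s : ℝ), s ≠ 0 → HasDerivAt (g k) (g (k + 1) s - 2 * (s ^ 3)⁻¹ * g k s) s)
    (hbound : ∀ k : ℕ, ∃ (C : ℝ) (m : ℕ), ∀ s : ℝ, s ≠ 0 → |s| < 1 → |g k s| ≤ C * |s|⁻¹ ^ m) :
    ContDiff ℝ ∞ (fun s : ℝ ↦ expNegInvGlue (s ^ 2) * g 0 s) := by
  set flat : ℕ → ℝ → ℝ := fun k s ↦ expNegInvGlue (s ^ 2) * g k s with hflat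
  have h0 : ∀ k, flat k 0 = 0 := fun k ↦ by simp [hflat]
  -- (1) every `flat k` tends to `0` at `0`
  have hsq : Tendsto (fun s : ℝ ↦ s ^ 2) (𝓝 0) (𝓝 0) := by
    simpa using ((continuous_pow 2).tendsto (0 : ℝ))
  have htend : ∀ k, Tendsto (flat k) (𝓝 0) (𝓝 0) := by
    intro k
    obtain ⟨C, m, hC⟩ := hbound k
    have hlim : Tendsto (fun s : ℝ ↦ |C| * (((s ^ 2)⁻¹) ^ m * expNegInvGlue (s ^ 2))) (𝓝 0) (𝓝 0) := by
      have h := ((expNegInvGlue.tendsto_polynomial_inv_mul_zero (Polynomial.X ^ m)).comp hsq).const_mul |C|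
      simp only [mul_zero] at h
      refine h.congr fun s ↦ ?_
      simp only [Function.comp_apply, Polynomial.eval_pow, Polynomial.eval_X]
    refine squeeze_zero_norm' ?_ hlim
    filter_upwards [Ioo_mem_nhds (show (-1 : ℝ) < 0 by norm_num) (show (0 : ℝ) < 1 by norm_num)]
      with s hs
    have hs1 : |s| < 1 := abs_lt.2 ⟨hs.1, hs.2⟩
    rcases eq_or_ne s 0 with rfl | hs0
    · rw [h0, norm_zero]
      exact mul_nonneg (abs_nonneg _) (mul_nonneg (pow_nonneg (inv_nonneg.2 (sq_nonneg _)) _)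
        (expNegInvGlue.nonneg _))
    · have hpos : 0 < |s| := abs_pos.2 hs0
      have hinv : |s|⁻¹ ≤ (s ^ 2)⁻¹ := by
        rw [← sq_abs]
        exact (inv_le_inv₀ hpos (pow_pos hpos 2)).2
          (by nlinarith [abs_nonneg s])
      have hpow : |s|⁻¹ ^ m ≤ ((s ^ 2)⁻¹) ^ m :=
        pow_le_pow_left₀ (inv_nonneg.2 hpos.le) hinv m
      rw [Real.norm_eq_abs, hflat]
      dsimp only
      rw [abs_mul, abs_of_nonneg (expNegInvGlue.nonneg _)]
      calc expNegInvGlue (s ^ 2) * |g k s|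
          ≤ expNegInvGlue (s ^ 2) * (C * |s|⁻¹ ^ m) :=
            mul_le_mul_of_nonneg_left (hC s hs0 hs1) (expNegInvGlue.nonneg _)
        _ ≤ expNegInvGlue (s ^ 2) * (|C| * ((s ^ 2)⁻¹) ^ m) := by
            refine mul_le_mul_of_nonneg_left ?_ (expNegInvGlue.nonneg _)
            calc C * |s|⁻¹ ^ m ≤ |C| * |s|⁻¹ ^ m :=
                  mul_le_mul_of_nonneg_right (le_abs_self C) (pow_nonneg (inv_nonneg.2 hpos.le) m)
              _ ≤ |C| * ((s ^ 2)⁻¹) ^ m := mul_le_mul_of_nonneg_left hpow (abs_nonneg C)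
        _ = |C| * (((s ^ 2)⁻¹) ^ m * expNegInvGlue (s ^ 2)) := by ring
  -- (2) `flat k` has derivative `flat (k + 1)` everywhere
  have hder : ∀ k s, HasDerivAt (flat k) (flat (k + 1) s) s := by
    intro k
    have hoff : ∀ s ≠ (0 : ℝ), HasDerivAt (flat k) (flat (k + 1) s) s := by
      intro s hs
      have h := (hasDerivAt_expNegInvGlue_sq s).mul (hderiv k s hs)
      refine h.congr_deriv ?_
      simp only [hflat]
      ring
    have hcont : ContinuousAt (flat k) 0 := by
      change Tendsto (flat k) (𝓝 0) (𝓝 (flat k 0))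
      rw [h0]
      exact htend k
    have hcont' : ContinuousAt (flat (k + 1)) 0 := by
      change Tendsto (flat (k + 1)) (𝓝 0) (𝓝 (flat (k + 1) 0))
      rw [h0]
      exact htend (k + 1)
    exact hasDerivAt_of_hasDerivAt_of_ne' hoff hcont hcont'
  -- (3) smoothness by induction on the order, uniformly in `k`
  have hall : ∀ (n : ℕ) (k : ℕ), ContDiff ℝ n (flat k) := by
    intro n
    induction n with
    | zero => exact fun k ↦ contDiff_zero.2 (continuous_iff_continuousAt.2 fun s ↦
        (hder k s).continuousAt)
    | succ n ih =>
      intro k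
      rw [show ((n + 1 : ℕ) : WithTop ℕ∞) = n + 1 from rfl]
      refine contDiff_succ_iff_deriv.2 ⟨fun s ↦ (hder k s).differentiableAt, by simp, ?_⟩
      have hd : deriv (flat k) = flat (k + 1) := funext fun s ↦ (hder k s).deriv
      rw [hd]
      exact ih (k + 1)
  exact contDiff_all_iff_nat.2 (fun n ↦ hall n 0) _

end FlatPhaseLocking

/-- **Flat phase locking** (binder-free conjunction of `contDiff_flatPhaseLocking_cos/_sin`, the registered
helper of this file): both phase-locked flat amplitudes are `C^∞` on `ℝ` for every phase rate. [folklore] -/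
theorem contDiff_flatPhaseLocking :
    ∀ α : ℝ, ContDiff ℝ ∞ (fun s : ℝ ↦ expNegInvGlue (s ^ 2) * Real.cos (α / s ^ 2)) ∧
      ContDiff ℝ ∞ (fun s : ℝ ↦ expNegInvGlue (s ^ 2) * Real.sin (α / s ^ 2)) :=
  fun α ↦ ⟨contDiff_flatPhaseLocking_cos α, contDiff_flatPhaseLocking_sin α⟩

end Summit.FinalStateConjecture.FinalStateConjecture.Theorems.OneLockedExplosion

end
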